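import Summits.QuantumFields.YangMills.Theorems.BalabanUVNodesK0V23Stub3ActivitySlotSuppliers
import Summits.QuantumFields.YangMills.Theorems.BalabanUVNodesK0V23Stub3BoxSuppliersAx
import Summits.QuantumFields.YangMills.Theorems.BalabanUVNodesU3LettersAtReadingChi

/-!
# K0ᴬ V24 stub 3, RE-CENTRED (`…Ax`) EDITION of `…K0V23Stub3ActivitySlotSuppliers` §2–§5: NODE O's β-box in N22's ACTIVITY-SLOT CURRENCY and in node U3's DECAY-SLOT CURRENCY
# at the re-centred β of record `betaOfRecord₁₃Ax` (β-slot `χ := chiβOfRecord₁₃Ax θ`), plus the re-centred edition of dag-n22-w3's N22 record row ((1.21) from activity slot + (S≈))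

WHAT.  The K0ᴬ target text (V24 `stub_absBetaBoxAtThm1WitnessCCMGenGridGZBAx13`, stmt-QuantumFields-27238) reads the RE-CENTRED β of record.  The centred suppliers file
`…K0V23Stub3ActivitySlotSuppliers` (k0-s3 lane) has a θ-free §1 (the VALUE half of N22's soft-localized two-point engine IS W1-19c's uniform windowed (5.10) letter for the
localized-sum family — imported and used verbatim here) and θ-indexed §2–§5 at the CENTRED letters.  This file is the by-name σ-image `X ↦ XAx` of §2–§5:
* §2 `windowedDecayUniformOfRecord₁₃Ax_of_activitySlots` — under the re-centred (1.7) law `Localizes17OfRecord₁₃Ax F N θ S emb` (RC-1's `Node00.LocalizedSum17Chi`) the engine's value bound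
  IS the re-centred uniform letter `WindowedDecayUniformOfRecord₁₃Ax F N θ C_unif δ₁` (transport: `…U3LettersAtReadingChi.windowedDecayUniformOfRecord₁₃Chi_iff_of_localizes`);
* §2b `polLimitsExistOfRecord₁₃Ax_of_activitySlots` — the re-centred edition of dag-n22-w3's record row: the (1.21)-existence letter `PolLimitsExistOfRecord₁₃Ax F N θ` from the activity slot,
  complexified probe readings, tails and the displayed law (S≈) (generic `YMDAG.N22.AtKernels.polLimitsExist_localizedSum_of_activitySlots` + `polLimitsExistOfRecord₁₃Chi_iff_of_localizes`);
* §3 `abs_betaOfRecord₁₃Ax_le_of_activitySlots`, `exists_absBetaBox_of_activitySlots_of_approxStable` — the sign-free box `|β₁₃ᴬˣ(θ)| ≤ β′₅₁₀(C_unif, δ₁)` on `]0, θ.γ]` from the value half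
  + (1.21) (INTENT-3's two-letter road, re-centred: `…K0V23Stub3BoxSuppliersAx.abs_betaOfRecord₁₃Ax_le_of_windowedDecayUniform_of_polLimitsExist`), resp. from activity-level letters + laws alone;
* §4 `abs_betaOfRecord₁₃Ax_le_of_decayBoundEA`, `exists_absBetaBox_of_decayBoundEA` — node U3's DECAY SLOT at the re-centred objects `DecayBound ((objectsOfRecord₁₃Ax F N θ ℓ).EA 0) (Window θ.γ) E₁ δ₁`
  ⟹ the box in one line;
* §5 `tokenFreeZBAx_of_decayBoundEAAtZB` — at the re-centred print-regime Z3 window members `θ₁₃ᶜᶜᴹᵂᶻᴮ·ᴬˣ(j; γ₀; a₀; …)`: the decay slot per radius ⟹ the TOKEN-FREE CORE of the re-centred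
  stub-3 text (`…K0V23Stub3BoxSuppliersAx.tokenFreeZBAx_of_windowBoxAtZB`).
Every signature is the centred one with `Localizes17OfRecord₁₃ ↦ Localizes17OfRecord₁₃Ax`, `WindowedDecayUniformOfRecord₁₃ ↦ …Ax`, `PolLimitsExistOfRecord₁₃ ↦ …Ax`, `betaOfRecord₁₃ ↦ betaOfRecord₁₃Ax`,
`objectsOfRecord₁₃ ↦ objectsOfRecord₁₃Ax`, `theta13OfThm1CCMWZB ↦ theta13OfThm1CCMWZBAx`; every proof is the centred proof with the re-centred lemma names (the χ-editions are definitionally the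
centred shapes at `χ := chiβOfRecord₁₃Ax θ`).

HONEST FRAMING (binding).  By-name composition over LANDED green N22 ∕ W1 ∕ K0 theorems + real bookkeeping; every engine input, the law (S≈), the (1.7) law and the decay slot are
HYPOTHESES (displayed, inhabited nowhere in the tree); NO estimate of Bałaban's proved or asserted; the token-free core ∕ V24 stub 3 `stub_absBetaBoxAtThm1WitnessCCMGenGridGZBAx13` NOT
proved ([I] §1 p.264 «uniformly bounded» STATED, proof unpublished [II] p.355); K0ᴬ stmt-QuantumFields-27238 NOT closed; K1ᴬ ∕ K3ᴬ OPEN; N22 untouched; N07 NOT discharged; counts UNMOVED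
(COUNT 8∕28 · K 1∕4); helper lane, count-neutral; R4 = the CONDITIONAL finite-𝕋⁴ rung `BalabanLadder.UV` at fixed `ε = L^(−K)` only — NOT continuum ∕ ℝ⁴ ∕ OS; the Yang–Mills mass gap
(Clay) is NOT proved by any of this.  Standard axioms only.
-/

noncomputable section

open Filter Topology Metric Set
open scoped BigOperators Matrix.Norms.L2Operator

namespace Summit.QuantumFields.YangMills.Theorems.K0V23Stub3ActivitySlotSuppliersAx

open Literature.MathematicalPhysics.QuantumFieldTheory.Balaban1983to89
open Literature.MathematicalPhysics.QuantumFieldTheory.Balaban1983to89.T4Continuum (T4Family)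
open Literature.MathematicalPhysics.QuantumFieldTheory.Balaban1983to89.T4OutputRate (Window DecayBound)
open Literature.MathematicalPhysics.QuantumFieldTheory.Balaban1983to89.FlowStep (Box mem_box BetaLowerH BetaUpperH)
open Literature.MathematicalPhysics.QuantumFieldTheory.Balaban1983to89.Node00 (TermFamily1 polWindow polScalar siteOfInt Stage13Params MatA mergedTermFamilyMatT TβOfRecord₁₃ chiβOfRecord₁₃Ax
  betaOfRecord₁₃Ax theta13OfThm1CCMWZBAx theta13OfThm1CCMWZBAx_γ U3Letters₁₁)
open Literature.MathematicalPhysics.QuantumFieldTheory.Balaban1983to89.Node00.Sect2 (domCount domSys CPair)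
open Literature.MathematicalPhysics.QuantumFieldTheory.Balaban1983to89.Node00.LocalizedSum17 (localizedSum ReadingMaps Localizes17OfRecord₁₃Ax)
open Literature.MathematicalPhysics.QuantumFieldTheory.Balaban1983to89.Node00.W1 (ClusterTower)
open Literature.MathematicalPhysics.QuantumFieldTheory.Balaban1983to89.Node00.U3OfKernels (histPrefix kernelA decayBound_EA_iff objectsOfRecord₁₃Ax)
open Literature.MathematicalPhysics.QuantumFieldTheory.Balaban1983to89.Node00.U3KernelLetters (PolLimitsExistOfRecord₁₃Ax WindowedDecayUniformOfRecord₁₃Ax)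
open Literature.MathematicalPhysics.QuantumFieldTheory.Balaban1983to89.Node00.U3KernelLetters2 (WindowedDecayUniform)
open Literature.MathematicalPhysics.QuantumFieldTheory.Balaban1983to89.B12Decay510 (delta1 delta1_pos)
open Literature.MathematicalPhysics.QuantumFieldTheory.Balaban1983to89.B12Decay510Window (K₁)
open Literature.MathematicalPhysics.QuantumFieldTheory.Balaban1983to89.B12Decay510Torus (distCT nearT)
open Literature.MathematicalPhysics.QuantumFieldTheory.Balaban1983to89.B12TreeDecay (K₀ kappa₀ K₀_pos)
open Literature.MathematicalPhysics.QuantumFieldTheory.Balaban1983to89.TreeLengthTorus (TPt torusTreeLen torusTreeLen_nonneg)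
open Literature.MathematicalPhysics.QuantumFieldTheory.Balaban1983to89.B12Sec2to5 (l1 Decay510 betaPrime510)
open YMDAG.N22.AtKernels (polLimitsExist_localizedSum_of_activitySlots)
open Summit.QuantumFields.YangMills.Theorems.K0V23Stub3ActivitySlotSuppliers (windowedDecayUniform_localizedSum_of_activitySlots)
open Summit.QuantumFields.YangMills.Theorems.K0V23Stub3BoxSuppliersAx (abs_betaOfRecord₁₃Ax_le_of_kernelDecayWindowUniform abs_betaOfRecord₁₃Ax_le_of_windowedDecayUniform_of_polLimitsExist exists_absBetaBox_of_windowedDecayUniform_of_polLimitsExist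
  tokenFreeZBAx_of_windowBoxAtZB)
open Summit.QuantumFields.YangMills.Theorems.U3LettersAtReadingChi (windowedDecayUniformOfRecord₁₃Chi_iff_of_localizes polLimitsExistOfRecord₁₃Chi_iff_of_localizes)

/-! ## §2  AT THE RECORD: under W1-20's law the engine's value bound IS W1-19c's UNIFORM LETTER OF RECORD -/

section Record

variable (F : T4Family) (N : ℕ) [NeZero N]

open Classical in
/-- **★★ W1-19c's UNIFORM WINDOWED (5.10) LETTER OF RECORD `WindowedDecayUniformOfRecord₁₃Ax F N θ C_unif δ₁` FROM ACTIVITY-LEVEL VALUE SLOTS** — towers `S K : ClusterTower (F.P K) (MatA N) M`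
and reading maps `emb : ReadingMaps F (MatA N) (MatA N)` with W1-20's law `Localizes17OfRecord₁₃Ax F N θ S emb`; the VALUE-half hypotheses of the engine at the record's β-chart (`θ.ρ8`, `θ.bV`) on
the window `]0, θ.γ]^ℕ` (§1 at `W := Window θ.γ`, transported along the law by `windowedDecayUniformOfRecord₁₃_iff_of_localizes`).  This is exactly the letter node N18's kernel road and the
(D4) read-out consume, and the `hU` of INTENT-3's two-letter box road.  CONDITIONAL; nothing asserted. [cite: Balaban1987RG1, (1.7) p.261, (5.10) p.293, (1.18) p.263, (1.20) p.264; Balaban1988RG2Cluster, (2.13)–(2.14) pp.14–15] -/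
theorem windowedDecayUniformOfRecord₁₃Ax_of_activitySlots (θ : Stage13Params F N) (m' : ℕ) (M : ℕ) [NeZero M] (hM : M = F.L ^ m')
    (S : (K : ℕ) → ClusterTower (F.P K) (MatA N) M) (emb : ReadingMaps F (MatA N) (MatA N)) (hloc : Localizes17OfRecord₁₃Ax F N θ S emb)
    (Wk : (K k : ℕ) → Set (Fin (k + 1) → ℝ)) (hWk : ∀ g ∈ Window θ.γ, ∀ K k, histPrefix g k ∈ Wk K k)
    (sp : (K k : ℕ) → (domSys (F.P K) M (k + 1)).Dom → Set (CPair (F.P K) (MatA N)))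
    {A R r₁ κ δ₀ B₃ r : ℝ}
    (hA : 0 ≤ A) (hr₁ : 0 ≤ r₁) (hκ : κ ≤ r₁) (hκ₀ : kappa₀ (4 * 2 ^ 4) (2 * 4) ≤ κ / 2) (hrate : r₁ + 2 * (64 * Real.log 162) + 2 ≤ R)
    (hsmall : A * Real.exp (5 * r₁ + 1) * K₀ 64 8 * 9 * 64 ≤ 1) (hδ₀ : 0 < δ₀) (hB₃ : 0 ≤ B₃) (hr : 0 < r)
    (h238 : ∀ K k, ((S K) k).Bound238 (Wk K k) (sp K k) A R)
    (Ec : ℕ → ℕ → Type*) [∀ K k, NormedAddCommGroup (Ec K k)] [∀ K k, NormedSpace ℂ (Ec K k)]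
    (ι : letI := θ.instVβ₁; letI := θ.instVβ₂
      (K k : ℕ) → (domSys (F.P K) M (k + 1)).Dom → ((Fin (F.P K).d → Site (F.P K) (k + 1) → θ.Vβ) →L[ℝ] Ec K k))
    (Φ : (K k : ℕ) → (domSys (F.P K) M (k + 1)).Dom → Ec K k → CPair (F.P K) (MatA N))
    (U : (K k : ℕ) → (domSys (F.P K) M (k + 1)).Dom → Set (Ec K k)) (hU : ∀ K k X, IsOpen (U K k X)) (hrU : ∀ K k X, ball (0 : Ec K k) r ⊆ U K k X)
    (hHhol : ∀ g ∈ Window θ.γ, ∀ (K k : ℕ) (X Z : (domSys (F.P K) M (k + 1)).Dom), Z.1 ⊆ X.1 →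
      DifferentiableOn ℂ (fun z => ((S K) k).H (histPrefix g k) (Φ K k X z) Z) (U K k X))
    (hΦemb : letI := θ.instVβ₁; letI := θ.instVβ₂
      ∀ (K k : ℕ) (X : (domSys (F.P K) M (k + 1)).Dom) (B : Fin (F.P K).d → Site (F.P K) (k + 1) → θ.Vβ),
        Φ K k X (ι K k X B) = emb K k (fun l t => NormedSpace.exp (θ.ρ8 (B l t))))
    (hΦsp : ∀ (K k : ℕ) (X : (domSys (F.P K) M (k + 1)).Dom), ∀ z ∈ U K k X, ∀ Z : (domSys (F.P K) M (k + 1)).Dom, Z.1 ⊆ X.1 → Φ K k X z ∈ sp K k Z)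
    (w : (K k : ℕ) → (domSys (F.P K) M (k + 1)).Dom → Site (F.P K) (k + 1) → ℝ) (hw₀ : ∀ K k X t, 0 ≤ w K k X t)
    (hw : letI := θ.instVβ₁; letI := θ.instVβ₂; letI := θ.instιβ
      ∀ (K k : ℕ) (X : (domSys (F.P K) M (k + 1)).Dom) (l : Fin (F.P K).d) (t : Site (F.P K) (k + 1)) (c : θ.ιβ),
        ‖ι K k X (Pi.single l (Pi.single t (θ.bV c)))‖ ≤ w K k X t)
    (htail : ∀ (K k : ℕ) (X : (domSys (F.P K) M (k + 1)).Dom) (t : Site (F.P K) (k + 1)),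
      let e : Site (F.P K) (k + 1) → TPt 4 (domCount (F.P K) M (k + 1) * M) := fun x i => (ZMod.cast (x i) : ZMod (domCount (F.P K) M (k + 1) * M))
      w K k X t ≤ B₃ * Real.exp (-δ₀ * distCT (domCount (F.P K) M (k + 1)) M (e t) (nearT (M := M) (e t) X))) :
    WindowedDecayUniformOfRecord₁₃Ax F N θ
      (16 * (Real.exp 1 * 9 * 64 * K₀ 64 8 ^ 2) * A * B₃ ^ 2 / r ^ 2 *
        Real.exp (delta1 δ₀ κ ((M : ℝ) * 4) * ((M : ℝ) * 4) * 3) * K₀ (4 * 2 ^ 4) (2 * 4) * K₁ 4 (δ₀ / 2) * 1)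
      (delta1 δ₀ κ ((M : ℝ) * 4)) := by
  letI := θ.instVβ₁; letI := θ.instVβ₂; letI := θ.instιβ
  exact (windowedDecayUniformOfRecord₁₃Chi_iff_of_localizes F N θ (chiβOfRecord₁₃Ax F N θ) S emb hloc _ _).2
    (windowedDecayUniform_localizedSum_of_activitySlots F m' M hM S emb θ.ρ8 θ.bV (Window θ.γ) Wk hWk sp hA hr₁ hκ hκ₀ hrate hsmall hδ₀ hB₃ hr
      h238 Ec ι Φ U hU hrU hHhol hΦemb hΦsp w hw₀ hw htail)

/-! ## §2b  dag-n22-w3's (1.21)-EXISTENCE LETTER OF RECORD FROM THE ACTIVITY SLOT + (S≈), re-centred edition (the N22 record row `YMDAG.N22.AtKernels.polLimitsExistOfRecord₁₃_of_activitySlots` at `χ := χβ·ᴬˣ(θ)`) -/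

section N22Row

variable {𝔸 : Type*} {M : ℕ} [NeZero M]

open Classical in
/-- ★★★ **THE (1.21)-EXISTENCE LETTER OF RECORD FROM W1's ACTIVITY-LEVEL VALUE SLOT + (S≈) AT A LOCALIZING READING** (LOCATED).  For towers `S` (cube side `M = L^{m′}`) read through
`emb` which LOCALIZE the merged term family of record (W1-20's displayed law `Localizes17OfRecord₁₃Ax F N θ S emb` — NODE A ∕ N10's), the hypotheses of
`polLimitsExist_localizedSum_of_activitySlots` at the record's β-chart `θ.ρ8 ∕ θ.bV` on the window `]0, θ.γ]^ℕ` give W1-19b's `PolLimitsExistOfRecord₁₃Ax F N θ` — the `hlim` ∕ `hL` slot of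
dag-n22-w3's (1.21) passage (`n22At_rateCarriers_of_kernels_pin`, `kernelDecayOfRecord₁₃_of_windowed`) and of dag-n27-w1's letters-level composer (`n22At_kernels_of_letters_guarded` &c.).
Nothing of the record is claimed to meet the hypotheses; (1.21)'s existence for the terms OF RECORD is NOT thereby proved — it is REDUCED to «activity slot + reading + tails + (S≈) + law». -/
theorem polLimitsExistOfRecord₁₃Ax_of_activitySlots (θ : Stage13Params F N) (m' : ℕ) (hM : M = F.L ^ m')
    (S : (K : ℕ) → ClusterTower (F.P K) 𝔸 M) (emb : ReadingMaps F (MatA N) 𝔸) (hloc : Localizes17OfRecord₁₃Ax F N θ S emb)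
    (Wk : (K k : ℕ) → Set (Fin (k + 1) → ℝ)) (hWk : ∀ g ∈ Window θ.γ, ∀ K k, histPrefix g k ∈ Wk K k)
    (sp : (K k : ℕ) → (domSys (F.P K) M (k + 1)).Dom → Set (CPair (F.P K) 𝔸)) {A R r₁ κ B₃ δ₀ r r₀ : ℝ}
    (hA : 0 ≤ A) (hr₁ : 0 ≤ r₁) (hκ0 : 0 < κ) (hκ : κ ≤ r₁) (hκ4 : kappa₀ (4 * 2 ^ 4) (2 * 4) ≤ κ / 2 / 2) (hrate : r₁ + 2 * (64 * Real.log 162) + 2 ≤ R)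
    (hsmall : A * Real.exp (5 * r₁ + 1) * K₀ 64 8 * 9 * 64 ≤ 1) (hB₃ : 0 ≤ B₃) (hδ₀ : 0 < δ₀) (hr : 0 < r)
    (h238 : ∀ K k, ((S K) k).Bound238 (Wk K k) (sp K k) A R)
    (Ec : ℕ → ℕ → Type*) [∀ K k, NormedAddCommGroup (Ec K k)] [∀ K k, NormedSpace ℂ (Ec K k)]
    (ιc : letI := θ.instVβ₁; letI := θ.instVβ₂; letI := θ.instιβ
      (K k : ℕ) → (domSys (F.P K) M (k + 1)).Dom → ((Fin (F.P K).d → Site (F.P K) (k + 1) → θ.Vβ) →L[ℝ] Ec K k))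
    (Φ : (K k : ℕ) → (domSys (F.P K) M (k + 1)).Dom → Ec K k → CPair (F.P K) 𝔸)
    (U : (K k : ℕ) → (domSys (F.P K) M (k + 1)).Dom → Set (Ec K k)) (hU : ∀ K k X, IsOpen (U K k X)) (hrU : ∀ K k X, ball (0 : Ec K k) r ⊆ U K k X)
    (hHhol : ∀ K k, ∀ hist ∈ Wk K k, ∀ (X Z : (domSys (F.P K) M (k + 1)).Dom), Z.1 ⊆ X.1 →
      DifferentiableOn ℂ (fun z => ((S K) k).H hist (Φ K k X z) Z) (U K k X))
    (hΦemb : letI := θ.instVβ₁; letI := θ.instVβ₂; letI := θ.instιβ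
      ∀ K k X (B : Fin (F.P K).d → Site (F.P K) (k + 1) → θ.Vβ),
        Φ K k X (ιc K k X B) = emb K k (fun l t => NormedSpace.exp (θ.ρ8 (B l t))))
    (hΦsp : ∀ K k X, ∀ z ∈ U K k X, ∀ Z : (domSys (F.P K) M (k + 1)).Dom, Z.1 ⊆ X.1 → Φ K k X z ∈ sp K k Z)
    (w : (K k : ℕ) → (domSys (F.P K) M (k + 1)).Dom → Site (F.P K) (k + 1) → ℝ) (hw₀ : ∀ K k X t, 0 ≤ w K k X t)
    (hw : letI := θ.instVβ₁; letI := θ.instVβ₂; letI := θ.instιβ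
      ∀ K k X (l : Fin (F.P K).d) (t : Site (F.P K) (k + 1)) (c : θ.ιβ), ‖ιc K k X (Pi.single l (Pi.single t (θ.bV c)))‖ ≤ w K k X t)
    (hwB : ∀ K k (X : (domSys (F.P K) M (k + 1)).Dom) (t : Site (F.P K) (k + 1)),
      w K k X t ≤ B₃ * Real.exp (-δ₀ * distCT (domCount (F.P K) M (k + 1)) M (fun i => (ZMod.cast (t i) : ZMod (domCount (F.P K) M (k + 1) * M)))
        (nearT (M := M) (fun i => (ZMod.cast (t i) : ZMod (domCount (F.P K) M (k + 1) * M))) X)))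
    (lo : (k K : ℕ) → (domSys (F.P K) M (k + 1)).Dom → Prop) [∀ k K, DecidablePred (lo k K)]
    (hlo : ∀ (k K : ℕ) (X : (domSys (F.P K) M (k + 1)).Dom), ¬ lo k K X →
      let e : Site (F.P K) (k + 1) → TPt 4 (domCount (F.P K) M (k + 1) * M) := fun x i => (ZMod.cast (x i) : ZMod (domCount (F.P K) M (k + 1) * M))
      (K : ℝ) ≤ torusTreeLen X.1 ∨ (K : ℝ) ≤ distCT (domCount (F.P K) M (k + 1)) M (e (siteOfInt F K (k + 1) 0)) (nearT (M := M) (e (siteOfInt F K (k + 1) 0)) X))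
    (hr₀ : r₀ < 1) (hr₀' : 0 ≤ r₀)
    (hS : letI := θ.instVβ₁; letI := θ.instVβ₂; letI := θ.instιβ
      ∀ g ∈ Window θ.γ, ∀ (k : ℕ) (μ ν : Fin 4) (z : Fin 4 → ℤ), ∃ (K₀ : ℕ) (C : ℝ), ∀ K : ℕ, K₀ ≤ K →
      |∑ X ∈ Finset.univ.filter (lo k (K + 1)), polScalar (fun U' => (((S (K + 1)) k).E (histPrefix g k) (emb (K + 1) k U') X).re) θ.ρ8 θ.bV (Fin.cast (F.P_d (K + 1)).symm μ) (siteOfInt F (K + 1) (k + 1) z) (Fin.cast (F.P_d (K + 1)).symm ν) (siteOfInt F (K + 1) (k + 1) 0) -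
        ∑ X ∈ Finset.univ.filter (lo k K), polScalar (fun U' => (((S K) k).E (histPrefix g k) (emb K k U') X).re) θ.ρ8 θ.bV (Fin.cast (F.P_d K).symm μ) (siteOfInt F K (k + 1) z) (Fin.cast (F.P_d K).symm ν) (siteOfInt F K (k + 1) 0)| ≤ C * r₀ ^ K) :
    PolLimitsExistOfRecord₁₃Ax F N θ := by
  letI := θ.instVβ₁; letI := θ.instVβ₂; letI := θ.instιβ
  exact (polLimitsExistOfRecord₁₃Chi_iff_of_localizes F N θ (chiβOfRecord₁₃Ax F N θ) S emb hloc).2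
    (polLimitsExist_localizedSum_of_activitySlots F m' M hM S emb θ.ρ8 θ.bV (Window θ.γ) Wk hWk sp hA hr₁ hκ0 hκ hκ4 hrate hsmall hB₃ hδ₀ hr h238
      Ec ιc Φ U hU hrU hHhol hΦemb hΦsp w hw₀ hw hwB lo hlo hr₀ hr₀' hS)

end N22Row

/-! ## §3  … hence, with (1.21), the sign-free box `|β₁₃(θ)| ≤ β′₅₁₀(C_unif, δ₁)` on the full window (INTENT-3's two-letter road) -/

open Classical in
/-- **★★ `|β₁₃(θ)_{k+1}(v)| ≤ β′₅₁₀(C_unif, δ₁)` ON EVERY BOX OF THE FULL WINDOW FROM THE VALUE HALF OF THE ENGINE + (1.21)** (`0 < κ`; `δ₁ = ½min{δ₀, κ(4M)⁻¹} > 0` by `delta1_pos`).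
NO YoungLipschitz slot, NO NE9, NO fading memory.  CONDITIONAL; nothing asserted. [cite: Balaban1987RG1, (1.20)–(1.22) p.264, §1 p.264, (5.10) p.293, (5.42) p.297] -/
theorem abs_betaOfRecord₁₃Ax_le_of_activitySlots (θ : Stage13Params F N) (hlim : PolLimitsExistOfRecord₁₃Ax F N θ) (m' : ℕ) (M : ℕ) [NeZero M] (hM : M = F.L ^ m')
    (S : (K : ℕ) → ClusterTower (F.P K) (MatA N) M) (emb : ReadingMaps F (MatA N) (MatA N)) (hloc : Localizes17OfRecord₁₃Ax F N θ S emb)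
    (Wk : (K k : ℕ) → Set (Fin (k + 1) → ℝ)) (hWk : ∀ g ∈ Window θ.γ, ∀ K k, histPrefix g k ∈ Wk K k)
    (sp : (K k : ℕ) → (domSys (F.P K) M (k + 1)).Dom → Set (CPair (F.P K) (MatA N)))
    {A R r₁ κ δ₀ B₃ r : ℝ} (hκpos : 0 < κ)
    (hA : 0 ≤ A) (hr₁ : 0 ≤ r₁) (hκ : κ ≤ r₁) (hκ₀ : kappa₀ (4 * 2 ^ 4) (2 * 4) ≤ κ / 2) (hrate : r₁ + 2 * (64 * Real.log 162) + 2 ≤ R)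
    (hsmall : A * Real.exp (5 * r₁ + 1) * K₀ 64 8 * 9 * 64 ≤ 1) (hδ₀ : 0 < δ₀) (hB₃ : 0 ≤ B₃) (hr : 0 < r)
    (h238 : ∀ K k, ((S K) k).Bound238 (Wk K k) (sp K k) A R)
    (Ec : ℕ → ℕ → Type*) [∀ K k, NormedAddCommGroup (Ec K k)] [∀ K k, NormedSpace ℂ (Ec K k)]
    (ι : letI := θ.instVβ₁; letI := θ.instVβ₂
      (K k : ℕ) → (domSys (F.P K) M (k + 1)).Dom → ((Fin (F.P K).d → Site (F.P K) (k + 1) → θ.Vβ) →L[ℝ] Ec K k))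
    (Φ : (K k : ℕ) → (domSys (F.P K) M (k + 1)).Dom → Ec K k → CPair (F.P K) (MatA N))
    (U : (K k : ℕ) → (domSys (F.P K) M (k + 1)).Dom → Set (Ec K k)) (hU : ∀ K k X, IsOpen (U K k X)) (hrU : ∀ K k X, ball (0 : Ec K k) r ⊆ U K k X)
    (hHhol : ∀ g ∈ Window θ.γ, ∀ (K k : ℕ) (X Z : (domSys (F.P K) M (k + 1)).Dom), Z.1 ⊆ X.1 →
      DifferentiableOn ℂ (fun z => ((S K) k).H (histPrefix g k) (Φ K k X z) Z) (U K k X))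
    (hΦemb : letI := θ.instVβ₁; letI := θ.instVβ₂
      ∀ (K k : ℕ) (X : (domSys (F.P K) M (k + 1)).Dom) (B : Fin (F.P K).d → Site (F.P K) (k + 1) → θ.Vβ),
        Φ K k X (ι K k X B) = emb K k (fun l t => NormedSpace.exp (θ.ρ8 (B l t))))
    (hΦsp : ∀ (K k : ℕ) (X : (domSys (F.P K) M (k + 1)).Dom), ∀ z ∈ U K k X, ∀ Z : (domSys (F.P K) M (k + 1)).Dom, Z.1 ⊆ X.1 → Φ K k X z ∈ sp K k Z)
    (w : (K k : ℕ) → (domSys (F.P K) M (k + 1)).Dom → Site (F.P K) (k + 1) → ℝ) (hw₀ : ∀ K k X t, 0 ≤ w K k X t)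
    (hw : letI := θ.instVβ₁; letI := θ.instVβ₂; letI := θ.instιβ
      ∀ (K k : ℕ) (X : (domSys (F.P K) M (k + 1)).Dom) (l : Fin (F.P K).d) (t : Site (F.P K) (k + 1)) (c : θ.ιβ),
        ‖ι K k X (Pi.single l (Pi.single t (θ.bV c)))‖ ≤ w K k X t)
    (htail : ∀ (K k : ℕ) (X : (domSys (F.P K) M (k + 1)).Dom) (t : Site (F.P K) (k + 1)),
      let e : Site (F.P K) (k + 1) → TPt 4 (domCount (F.P K) M (k + 1) * M) := fun x i => (ZMod.cast (x i) : ZMod (domCount (F.P K) M (k + 1) * M))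
      w K k X t ≤ B₃ * Real.exp (-δ₀ * distCT (domCount (F.P K) M (k + 1)) M (e t) (nearT (M := M) (e t) X)))
    (k : ℕ) (v : Fin (k + 1) → ℝ) (hv : v ∈ Box θ.γ k) :
    |betaOfRecord₁₃Ax F N θ k v| ≤ betaPrime510 4
      (16 * (Real.exp 1 * 9 * 64 * K₀ 64 8 ^ 2) * A * B₃ ^ 2 / r ^ 2 *
        Real.exp (delta1 δ₀ κ ((M : ℝ) * 4) * ((M : ℝ) * 4) * 3) * K₀ (4 * 2 ^ 4) (2 * 4) * K₁ 4 (δ₀ / 2) * 1)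
      (delta1 δ₀ κ ((M : ℝ) * 4)) := by
  have hM4 : (0 : ℝ) < (M : ℝ) * 4 := by
    have : (0 : ℝ) < (M : ℝ) := Nat.cast_pos.2 (Nat.pos_of_neZero M)
    positivity
  exact abs_betaOfRecord₁₃Ax_le_of_windowedDecayUniform_of_polLimitsExist F N θ (delta1_pos hδ₀ hκpos hM4) hlim
    (windowedDecayUniformOfRecord₁₃Ax_of_activitySlots F N θ m' M hM S emb hloc Wk hWk sp hA hr₁ hκ hκ₀ hrate hsmall hδ₀ hB₃ hr h238 Ec ι Φ U hU hrU
      hHhol hΦemb hΦsp w hw₀ hw htail) k v hv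

open Classical in
/-- **★★★ THE SIGN-FREE BOX ON N22's ACTIVITY-LEVEL LETTERS + LAWS ALONE** (`0 < θ.γ`): the (1.21) letter is dag-n22-w3's `polLimitsExistOfRecord₁₃_of_activitySlots` from the SAME
towers ∕ reading ∕ value slot ∕ complexified readings ∕ tails plus the displayed law (S≈) «approximate cross-volume stability of the localized polarisation sums» (locality cut `lo` with
`hlo`, ratio `0 ≤ r₀ < 1`, `hS`), Road 1's sharper `κ₀(64,8) ≤ κ∕4`, holomorphy on the prefix sets; ⊢ `∃ β′ ≥ 0`, `−β′ ≤ β₁₃(θ) ≤ β′` on every `]0, θ.γ]^{k+1}` (`β′ = β′₅₁₀(C_unif, δ₁)`).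
NO kernel-level letter remains.  CONDITIONAL on the activity-level hypotheses (displayed, inhabited nowhere); nothing of Bałaban asserted. [cite: Balaban1987RG1, (1.7) p.261, (1.18) p.263, (1.20)–(1.22) p.264, §1 p.264, (5.10) p.293; Balaban1988RG2Cluster, (2.13)–(2.14) pp.14–15; Balaban1989LargeFieldII, p.355] -/
theorem exists_absBetaBox_of_activitySlots_of_approxStable (θ : Stage13Params F N) (hγ : 0 < θ.γ) (m' : ℕ) (M : ℕ) [NeZero M] (hM : M = F.L ^ m')
    (S : (K : ℕ) → ClusterTower (F.P K) (MatA N) M) (emb : ReadingMaps F (MatA N) (MatA N)) (hloc : Localizes17OfRecord₁₃Ax F N θ S emb)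
    (Wk : (K k : ℕ) → Set (Fin (k + 1) → ℝ)) (hWk : ∀ g ∈ Window θ.γ, ∀ K k, histPrefix g k ∈ Wk K k)
    (sp : (K k : ℕ) → (domSys (F.P K) M (k + 1)).Dom → Set (CPair (F.P K) (MatA N)))
    {A R r₁ κ δ₀ B₃ r r₀ : ℝ} (hκpos : 0 < κ)
    (hA : 0 ≤ A) (hr₁ : 0 ≤ r₁) (hκ : κ ≤ r₁) (hκ4 : kappa₀ (4 * 2 ^ 4) (2 * 4) ≤ κ / 2 / 2) (hrate : r₁ + 2 * (64 * Real.log 162) + 2 ≤ R)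
    (hsmall : A * Real.exp (5 * r₁ + 1) * K₀ 64 8 * 9 * 64 ≤ 1) (hδ₀ : 0 < δ₀) (hB₃ : 0 ≤ B₃) (hr : 0 < r)
    (h238 : ∀ K k, ((S K) k).Bound238 (Wk K k) (sp K k) A R)
    (Ec : ℕ → ℕ → Type*) [∀ K k, NormedAddCommGroup (Ec K k)] [∀ K k, NormedSpace ℂ (Ec K k)]
    (ι : letI := θ.instVβ₁; letI := θ.instVβ₂
      (K k : ℕ) → (domSys (F.P K) M (k + 1)).Dom → ((Fin (F.P K).d → Site (F.P K) (k + 1) → θ.Vβ) →L[ℝ] Ec K k))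
    (Φ : (K k : ℕ) → (domSys (F.P K) M (k + 1)).Dom → Ec K k → CPair (F.P K) (MatA N))
    (U : (K k : ℕ) → (domSys (F.P K) M (k + 1)).Dom → Set (Ec K k)) (hU : ∀ K k X, IsOpen (U K k X)) (hrU : ∀ K k X, ball (0 : Ec K k) r ⊆ U K k X)
    (hHhol : ∀ K k, ∀ hist ∈ Wk K k, ∀ (X Z : (domSys (F.P K) M (k + 1)).Dom), Z.1 ⊆ X.1 →
      DifferentiableOn ℂ (fun z => ((S K) k).H hist (Φ K k X z) Z) (U K k X))
    (hΦemb : letI := θ.instVβ₁; letI := θ.instVβ₂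
      ∀ (K k : ℕ) (X : (domSys (F.P K) M (k + 1)).Dom) (B : Fin (F.P K).d → Site (F.P K) (k + 1) → θ.Vβ),
        Φ K k X (ι K k X B) = emb K k (fun l t => NormedSpace.exp (θ.ρ8 (B l t))))
    (hΦsp : ∀ (K k : ℕ) (X : (domSys (F.P K) M (k + 1)).Dom), ∀ z ∈ U K k X, ∀ Z : (domSys (F.P K) M (k + 1)).Dom, Z.1 ⊆ X.1 → Φ K k X z ∈ sp K k Z)
    (w : (K k : ℕ) → (domSys (F.P K) M (k + 1)).Dom → Site (F.P K) (k + 1) → ℝ) (hw₀ : ∀ K k X t, 0 ≤ w K k X t)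
    (hw : letI := θ.instVβ₁; letI := θ.instVβ₂; letI := θ.instιβ
      ∀ (K k : ℕ) (X : (domSys (F.P K) M (k + 1)).Dom) (l : Fin (F.P K).d) (t : Site (F.P K) (k + 1)) (c : θ.ιβ),
        ‖ι K k X (Pi.single l (Pi.single t (θ.bV c)))‖ ≤ w K k X t)
    (htail : ∀ (K k : ℕ) (X : (domSys (F.P K) M (k + 1)).Dom) (t : Site (F.P K) (k + 1)),
      let e : Site (F.P K) (k + 1) → TPt 4 (domCount (F.P K) M (k + 1) * M) := fun x i => (ZMod.cast (x i) : ZMod (domCount (F.P K) M (k + 1) * M))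
      w K k X t ≤ B₃ * Real.exp (-δ₀ * distCT (domCount (F.P K) M (k + 1)) M (e t) (nearT (M := M) (e t) X)))
    (lo : (k K : ℕ) → (domSys (F.P K) M (k + 1)).Dom → Prop) [∀ k K, DecidablePred (lo k K)]
    (hlo : ∀ (k K : ℕ) (X : (domSys (F.P K) M (k + 1)).Dom), ¬ lo k K X →
      let e : Site (F.P K) (k + 1) → TPt 4 (domCount (F.P K) M (k + 1) * M) := fun x i => (ZMod.cast (x i) : ZMod (domCount (F.P K) M (k + 1) * M))
      (K : ℝ) ≤ torusTreeLen X.1 ∨ (K : ℝ) ≤ distCT (domCount (F.P K) M (k + 1)) M (e (siteOfInt F K (k + 1) 0)) (nearT (M := M) (e (siteOfInt F K (k + 1) 0)) X))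
    (hr₀ : r₀ < 1) (hr₀' : 0 ≤ r₀)
    (hS : letI := θ.instVβ₁; letI := θ.instVβ₂; letI := θ.instιβ
      ∀ g ∈ Window θ.γ, ∀ (k : ℕ) (μ ν : Fin 4) (z : Fin 4 → ℤ), ∃ (K₀ : ℕ) (C : ℝ), ∀ K : ℕ, K₀ ≤ K →
      |∑ X ∈ Finset.univ.filter (lo k (K + 1)), polScalar (fun U' => (((S (K + 1)) k).E (histPrefix g k) (emb (K + 1) k U') X).re) θ.ρ8 θ.bV
            (Fin.cast (F.P_d (K + 1)).symm μ) (siteOfInt F (K + 1) (k + 1) z) (Fin.cast (F.P_d (K + 1)).symm ν) (siteOfInt F (K + 1) (k + 1) 0) -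
        ∑ X ∈ Finset.univ.filter (lo k K), polScalar (fun U' => (((S K) k).E (histPrefix g k) (emb K k U') X).re) θ.ρ8 θ.bV
            (Fin.cast (F.P_d K).symm μ) (siteOfInt F K (k + 1) z) (Fin.cast (F.P_d K).symm ν) (siteOfInt F K (k + 1) 0)| ≤ C * r₀ ^ K) :
    ∃ β' : ℝ, 0 ≤ β' ∧ BetaLowerH (-β') θ.γ (betaOfRecord₁₃Ax F N θ) ∧ BetaUpperH β' θ.γ (betaOfRecord₁₃Ax F N θ) := by
  have hκ₀ : kappa₀ (4 * 2 ^ 4) (2 * 4) ≤ κ / 2 := hκ4.trans (by linarith)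
  have hHholW : ∀ g ∈ Window θ.γ, ∀ (K k : ℕ) (X Z : (domSys (F.P K) M (k + 1)).Dom), Z.1 ⊆ X.1 →
      DifferentiableOn ℂ (fun z => ((S K) k).H (histPrefix g k) (Φ K k X z) Z) (U K k X) :=
    fun g hg K k X Z hZX => hHhol K k (histPrefix g k) (hWk g hg K k) X Z hZX
  have hlim : PolLimitsExistOfRecord₁₃Ax F N θ :=
    polLimitsExistOfRecord₁₃Ax_of_activitySlots F N θ m' hM S emb hloc Wk hWk sp hA hr₁ hκpos hκ hκ4 hrate hsmall hB₃ hδ₀ hr h238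
      Ec ι Φ U hU hrU hHhol hΦemb hΦsp w hw₀ hw htail lo hlo hr₀ hr₀' hS
  have hM4 : (0 : ℝ) < (M : ℝ) * 4 := by
    have : (0 : ℝ) < (M : ℝ) := Nat.cast_pos.2 (Nat.pos_of_neZero M)
    positivity
  exact exists_absBetaBox_of_windowedDecayUniform_of_polLimitsExist F N θ (delta1_pos hδ₀ hκpos hM4) hγ hlim
    (windowedDecayUniformOfRecord₁₃Ax_of_activitySlots F N θ m' M hM S emb hloc Wk hWk sp hA hr₁ hκ hκ₀ hrate hsmall hδ₀ hB₃ hr h238 Ec ι Φ U hU hrU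
      hHholW hΦemb hΦsp w hw₀ hw htail)

/-! ## §4  NODE U3's DECAY SLOT ⟹ the box in one line (the OUTPUT SHAPE of N22-c's J41 and of N18's `decayBound_EA_of_windowedDecayUniform`) -/

/-- **★★ NODE U3's DECAY SLOT OF RECORD ⟹ `|β₁₃(θ)_{k+1}(v)| ≤ β′₅₁₀(E₁, δ₁)` ON EVERY BOX OF THE FULL WINDOW** (`0 < δ₁`): `DecayBound ((objectsOfRecord₁₃Ax F N θ ℓ).EA 0) (Window θ.γ) E₁ δ₁`
— the conclusion shape of dag-n22-c's J41 `decayBound_objectsOfRecord₁₃_of_outputCoordHolo` (output-level margin datum) and of dag-n18-w4's junction `decayBound_EA_of_windowedDecayUniform`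
(uniform letter + (1.21)) — is, by W1-19's `decayBound_EA_iff`, one-constant (5.10) decay of the limiting kernels over the window; INTENT-3's `abs_betaOfRecord₁₃Ax_le_of_kernelDecayWindowUniform`
reads the box off.  θ-GENERIC; CONDITIONAL on the slot; nothing asserted. [cite: Balaban1987RG1, (1.18) p.263, (1.20)–(1.22) p.264, §1 p.264, (5.10) p.293, (5.42) p.297] -/
theorem abs_betaOfRecord₁₃Ax_le_of_decayBoundEA (θ : Stage13Params F N) (ℓ : U3Letters₁₁) {E₁ δ₁ : ℝ} (hδ : 0 < δ₁)
    (h : DecayBound ((objectsOfRecord₁₃Ax F N θ ℓ).EA 0) (Window θ.γ) E₁ δ₁) (k : ℕ) (v : Fin (k + 1) → ℝ) (hv : v ∈ Box θ.γ k) :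
    |betaOfRecord₁₃Ax F N θ k v| ≤ betaPrime510 4 E₁ δ₁ := by
  letI := θ.instVβ₁; letI := θ.instVβ₂; letI := θ.instιβ
  have hdec := (decayBound_EA_iff F (mergedTermFamilyMatT F N (TβOfRecord₁₃ F N) (chiβOfRecord₁₃Ax F N θ) θ.εbg) θ.ρ8 θ.bV (Window θ.γ) E₁ δ₁).1 h
  exact abs_betaOfRecord₁₃Ax_le_of_kernelDecayWindowUniform F N θ hδ le_rfl (fun g hg k => hdec g hg k 0 1) k v hv

/-- **★★ THE SIGN-FREE β-BOX ON THE FULL WINDOW FROM NODE U3's DECAY SLOT** (∃-form with `0 ≤ β′`; `0 < θ.γ`).  θ-GENERIC; CONDITIONAL on the slot. [cite: Balaban1987RG1, (1.20)–(1.22) p.264, §1 p.264 («uniformly bounded»), (5.10) p.293] -/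
theorem exists_absBetaBox_of_decayBoundEA (θ : Stage13Params F N) (ℓ : U3Letters₁₁) {E₁ δ₁ : ℝ} (hδ : 0 < δ₁) (hγ : 0 < θ.γ)
    (h : DecayBound ((objectsOfRecord₁₃Ax F N θ ℓ).EA 0) (Window θ.γ) E₁ δ₁) :
    ∃ β' : ℝ, 0 ≤ β' ∧ BetaLowerH (-β') θ.γ (betaOfRecord₁₃Ax F N θ) ∧ BetaUpperH β' θ.γ (betaOfRecord₁₃Ax F N θ) := by
  have key := abs_betaOfRecord₁₃Ax_le_of_decayBoundEA F N θ ℓ hδ h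
  have hv0 : (fun _ : Fin (0 + 1) => θ.γ) ∈ Box θ.γ 0 := mem_box.mpr fun _ => ⟨hγ, le_rfl⟩
  exact ⟨betaPrime510 4 E₁ δ₁, (abs_nonneg _).trans (key 0 _ hv0), fun k v hv => (abs_le.mp (key k v hv)).1, fun k v hv => (abs_le.mp (key k v hv)).2⟩

end Record

/-! ## §5  At the print-regime Z3 window members: the decay slot per radius ⟹ THE TOKEN-FREE CORE of the V23 stub-3ᴬ′ᴮ text -/

section ZB

variable (F : T4Family)

/-- **★★ NODE U3's DECAY SLOT AT A WINDOW MEMBER, PER RADIUS ⟹ THE TOKEN-FREE CORE**: for every `a₀ > 0` SOME `γ₀ ∈ ]0, ½]`, `ε₂₉ > 0`, letters, a block `ℓ`, a rate `δ₁ > 0` and a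
constant `E₁` with `DecayBound ((objectsOfRecord₁₃Ax F 2 θ ℓ).EA 0) (Window γ₀) E₁ δ₁` at `θ := θ₁₃ᶜᶜᴹᵂᶻᴮ(j; γ₀; a₀; ε₀, ε₂₉; B₃, B₃′, a₀, a₁; Efl, logz)` (window `γ₀`) ⟹ the token-free core
(§4 at `θ`, then INTENT-3's window edition).  With §2∕§3 at `θ` (activity currency) or dag-n22-c's J41 ∕ node N18's junction at `θ` as the slot's producer, this is the V23-road form of the
residue's `absBoxAt_of_activitySlotsAtWindowWitness` road the K1 face of record consumed.  CONDITIONAL on the slot; nothing asserted. [cite: Balaban1987RG1, (1.18) p.263, (1.20)–(1.22) p.264, §1 p.264, (5.10) p.293; Balaban1989LargeFieldII, p.355] -/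
theorem tokenFreeZBAx_of_decayBoundEAAtZB
    (h : ∀ a₀ : ℝ, 0 < a₀ → ∃ (γ₀ ε₂₉ : ℝ) (j : ℕ) (ε₀ B₃ B₃' a₁ : ℝ) (Efl logz : B12.RunParams → ℕ → ℝ) (ℓ : U3Letters₁₁) (E₁ δ₁ : ℝ),
      0 < γ₀ ∧ γ₀ ≤ 1 / 2 ∧ 0 < ε₂₉ ∧ 0 < δ₁ ∧
      DecayBound ((objectsOfRecord₁₃Ax F 2 (theta13OfThm1CCMWZBAx F 2 j γ₀ a₀ ε₀ ε₂₉ B₃ B₃' a₀ a₁ Efl logz) ℓ).EA 0) (Window γ₀) E₁ δ₁) :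
    ∀ a₀ : ℝ, 0 < a₀ → ∃ γ₀ ε₂₉ β' : ℝ, 0 < γ₀ ∧ 0 < ε₂₉ ∧ ∀ (j : ℕ) (ε₀ B₃ B₃' a₁ : ℝ),
      BetaLowerH (-β') γ₀ (betaOfRecord₁₃Ax F 2 (theta13OfThm1CCMWZBAx F 2 j (1 / 2) a₀ ε₀ ε₂₉ B₃ B₃' a₀ a₁ (fun _ _ => 0) (fun _ _ => 0))) ∧
      BetaUpperH β' γ₀ (betaOfRecord₁₃Ax F 2 (theta13OfThm1CCMWZBAx F 2 j (1 / 2) a₀ ε₀ ε₂₉ B₃ B₃' a₀ a₁ (fun _ _ => 0) (fun _ _ => 0))) := by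
  refine tokenFreeZBAx_of_windowBoxAtZB F fun a₀ ha₀ => ?_
  obtain ⟨γ₀, ε₂₉, j, ε₀, B₃, B₃', a₁, Efl, logz, ℓ, E₁, δ₁, hγ₀, hγhalf, hε', hδ, hD⟩ := h a₀ ha₀
  have hγθ : (theta13OfThm1CCMWZBAx F 2 j γ₀ a₀ ε₀ ε₂₉ B₃ B₃' a₀ a₁ Efl logz).γ = γ₀ := theta13OfThm1CCMWZBAx_γ F 2 j γ₀ a₀ ε₀ ε₂₉ B₃ B₃' a₀ a₁ Efl logz
  have hγpos : 0 < (theta13OfThm1CCMWZBAx F 2 j γ₀ a₀ ε₀ ε₂₉ B₃ B₃' a₀ a₁ Efl logz).γ := by rw [hγθ]; exact hγ₀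
  rw [← hγθ] at hD
  obtain ⟨β', -, hlow, hup⟩ := exists_absBetaBox_of_decayBoundEA F 2 _ ℓ hδ hγpos hD
  rw [hγθ] at hlow hup
  exact ⟨γ₀, ε₂₉, β', j, ε₀, B₃, B₃', a₁, Efl, logz, hγ₀, hγhalf, hε', hlow, hup⟩

end ZB

end Summit.QuantumFields.YangMills.Theorems.K0V23Stub3ActivitySlotSuppliersAx

end
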